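import Summits.ResolutionOfSingularities.ResolutionOfSingularities.Theorems.EquisingularLiftEquisingularLiftNatInCarrierSection
import Summits.ResolutionOfSingularities.ResolutionOfSingularities.Theorems.EquisingularLiftEquisingularLiftNatHorizontalForced
import Summits.ResolutionOfSingularities.ResolutionOfSingularities.Theorems.EquisingularLiftEquisingularLiftNatRegularOfSpecialFibre
import Summits.ResolutionOfSingularities.ResolutionOfSingularities.Theorems.EquisingularLiftEquisingularLiftSectionKer
import Literature.AlgebraicGeometry.Resolution.StalkIdealGenerization
import Literature.AlgebraicGeometry.Resolution.SncStrata
import Literature.AlgebraicGeometry.Resolution.ArithmeticalThreefolds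
import HarnessLib

/-!
# [OURS · L1 W4.5(b) · EL♮(3)] HSUB(ReachTC⁺)₃ brick `inv_base`, B6b ★ T-AXIS-SECTION: the section of the stage THROUGH the
# cone point `p_c` and ON the axis `V(C_axis)`, `C_axis = (ker s)·𝒪_{X₁} ⊔ St L₁ ⊔ St L₂`, with `(ker s_c)_{p_c} = (C_axis)_{p_c}`

Crux chain w45b (cell `res-hironaka`, slot W4.5(b)), working crux **EL♮** = stmt-ResolutionOfSingularities-20038, child **EL♮(3)** =
stmt-ResolutionOfSingularities-20148, route EquisingularLift, line `sections`, registered stub `stub_elnat_tcPlusPointResolution`;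
assembly HSUB(ReachTC⁺)₃ of res-L1-w45b-stub-1 (brick `inv_base`; res-type-100's B6 split 2026-08-27T14:56:25Z, object **B6b**,
booked to res-D-pv-051 by res-L1-w45b-plan-1 14:59:15Z). HONEST FRAMING: OURS; NOT a statement of any manuscript; AI-written,
weaker than expert review. No `sorry`; standard axioms. `--supports stmt-ResolutionOfSingularities-20148 --as helper`. DEF-FREE.

WHAT. res-type-100's B6b asks, in the HΔTC₃ binders (stage `X₁ —τ₁→ X′ —r′→ Spec O`, model square `j₂ : F₂ → X₁`, closed point
`y′` of the trace, adapted frame `c`, `p_c := j₂ y′`), for a SECTION `s_c : Spec O → X₁` of `τ₁ ≫ r′` with `s_c(s₀) = p_c`, lying ON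
the axis `V(C_axis)`, `C_axis := (ker s).comap τ₁ ⊔ St_{τ₁} L₁ ⊔ St_{τ₁} L₂` (`L_l` the prescribed-germ divisors of `c_l`), and with
`(ker s_c)_{p_c} = (C_axis)_{p_c}` (`= (χ(c₀/1), χ(c₁/c₀), χ(c₂/c₀))` once B6a's chart-`0` presentation identifies the stalk).
This file proves it for an ARBITRARY ideal sheaf `C` on a proper stage `f : X₁ → Spec O` with a model square, from exactly three
inputs at `p = j₂ y′` — the shape in which B6a (T-PRES-UP, res-type-100) delivers them:

* `(hsupp)` `p` is the ONLY point of `supp C` on the special fibre;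
* `(eO)` the quotient stalk `𝒪_{X₁,p} ⧸ C_p ≃+* O` («`𝒪_{p_c}/(c₀,u₁,u₂) ≅ O`»);
* `(hfib)` the special fibre `V(C·𝒪_{F₂})` is regular over `y′` — supplied from «`(C.comap j₂)_{y′} = 𝔪_{y′}`» by
  `isRegularLocalRing_stalk_subscheme_of_stalkIdeal_eq_maximalIdeal`.

ROUTE (res-L1-w45b-plan-1's booking, verbatim): `V(C)` is REGULAR (at its unique special point by `eO`, everywhere by res-type-032's
`Scheme.isRegular_subscheme_of_forall_over_closedPoint`) and HORIZONTAL (the generisation `η_𝔞` of `p` given by the prime `𝔞 = C_p`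
lies in `supp C` and off the special fibre — else `η_𝔞 = p`, `𝔞 = 𝔪_p` and `O` would be a field), hence `V(C) → Spec O` is FLAT
(`flat_subschemeι_comp_of_horizontal`, …NatHorizontalForced); then res-L1-w45b-stub-1's `exists_inCarrier_section` (p528314) gives the
section `s_c` with `C ≤ ker s_c`; finally `(ker s_c)_p = C_p`: `C_p ≤ (ker s_c)_p`, both are primes (`V(ker s_c) ≅ Spec O` is regular),
`(ker s_c)_p ≠ 𝔪_p` (the generic point `s_c(η)` is a second point of `V(ker s_c)` generising `p`), and a prime strictly above `𝔞`
in `𝒪_p ⧸ 𝔞 ≅ O` is maximal (`eq_of_le_of_quotient_ringEquiv_of_ne_maximalIdeal`).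

* `eq_of_le_of_quotient_ringEquiv_of_ne_maximalIdeal` — the prime-ideal bookkeeping in `𝒪_p`;
* `isRegularLocalRing_stalk_subscheme_of_stalkIdeal_eq_maximalIdeal` — «`D_y = 𝔪_y`» ⇒ `V(D)` regular over `y`;
* **`exists_axisSection`** — THE OBJECT (generic `C`; instantiate `f := τ₁ ≫ r′`, `C := C_axis`).

References: EGA IV 18.5.17 [Grothendieck1967]; Hartshorne III 9.7 [Hartshorne1977]; Stacks 01J7 [StacksProject]; tree
`exists_inCarrier_section` (p528314), `flat_subschemeι_comp_of_horizontal`, `Scheme.isRegular_subscheme_of_forall_over_closedPoint`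
(p504250), `section_isClosedImmersion_and_isRegular_ker`, `Literature…StalkIdealGenerization` / `SncStrata` (`primeOfSpecializes`).
-/

set_option linter.dupNamespace false -- mandated namespace `Summit.<Summit>.<Problem>` of this single-conjunct summit
set_option linter.overlappingInstances false -- signatures carry `[IsDomain O] [IsDiscreteValuationRing O]`

noncomputable section

open CategoryTheory CategoryTheory.Limits AlgebraicGeometry TopologicalSpace Topology IsLocalRing
open Literature.AlgebraicGeometry.Resolution
open AlgebraicGeometry.Scheme.IdealSheafData
open Summit.ResolutionOfSingularities.ResolutionOfSingularities.Cruxes.EquisingularLift.StrataSplit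

namespace Summit.ResolutionOfSingularities.ResolutionOfSingularities.Cruxes.EquisingularLiftNat.Sections

/-! ## Two pieces of local algebra -/

/-- **A prime between `𝔞` and `𝔪` when `A ⧸ 𝔞` is a discrete valuation ring.** In a local ring `A`, if `A ⧸ 𝔞 ≃+* O`
with `O` a discrete valuation ring and `𝔨 ⊇ 𝔞` is a prime ideal other than the maximal ideal, then `𝔨 = 𝔞` (the image of
`𝔨` in the principal ideal domain `A ⧸ 𝔞` is a prime, and a non-zero prime there is maximal). [folklore] -/
theorem eq_of_le_of_quotient_ringEquiv_of_ne_maximalIdeal {A : Type*} [CommRing A] [IsLocalRing A] (O : Type*)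
    [CommRing O] [IsDomain O] [IsDiscreteValuationRing O] {𝔞 𝔨 : Ideal A} (e : (A ⧸ 𝔞) ≃+* O) (hle : 𝔞 ≤ 𝔨)
    [h𝔨 : 𝔨.IsPrime] (hne : 𝔨 ≠ maximalIdeal A) : 𝔨 = 𝔞 := by
  refine le_antisymm ?_ hle
  haveI : IsDomain (A ⧸ 𝔞) := MulEquiv.isDomain O e.toMulEquiv
  haveI : IsPrincipalIdealRing (A ⧸ 𝔞) := IsPrincipalIdealRing.of_surjective e.symm.toRingHom e.symm.surjective
  have hker : RingHom.ker (Ideal.Quotient.mk 𝔞) ≤ 𝔨 := by rw [Ideal.mk_ker]; exact hle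
  have hprime : (𝔨.map (Ideal.Quotient.mk 𝔞)).IsPrime :=
    Ideal.map_isPrime_of_surjective Ideal.Quotient.mk_surjective hker
  by_contra hcontra
  have hne' : 𝔨.map (Ideal.Quotient.mk 𝔞) ≠ ⊥ := by
    intro h
    rw [Ideal.map_eq_bot_iff_le_ker, Ideal.mk_ker] at h
    exact hcontra h
  haveI hmax : (𝔨.map (Ideal.Quotient.mk 𝔞)).IsMaximal := hprime.isMaximal hne'
  have hcomap : (𝔨.map (Ideal.Quotient.mk 𝔞)).comap (Ideal.Quotient.mk 𝔞) = 𝔨 := by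
    rw [Ideal.comap_map_of_surjective _ Ideal.Quotient.mk_surjective, ← RingHom.ker_eq_comap_bot, Ideal.mk_ker,
      sup_eq_left.mpr hle]
  have h𝔨max : 𝔨.IsMaximal := by
    rw [← hcomap]
    exact Ideal.comap_isMaximal_of_surjective _ Ideal.Quotient.mk_surjective
  exact hne (IsLocalRing.eq_maximalIdeal h𝔨max)

/-- **«`D_y = 𝔪_y`» ⇒ `V(D)` is regular over `y`**: if the stalk of an ideal sheaf `D` at `y` is the maximal ideal, the local
ring of `V(D)` at its point over `y` is the residue field, a regular local ring. (Converts res-type-100's B6a clause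
«`(C_axis.comap j₂)_{y′} = 𝔪_{y′}`» into the `hfib` binder of `exists_inCarrier_section`.) [folklore] -/
theorem isRegularLocalRing_stalk_subscheme_of_stalkIdeal_eq_maximalIdeal {Y : Scheme.{0}} (D : Y.IdealSheafData) (y : Y)
    (h : stalkIdeal D y = maximalIdeal (Y.presheaf.stalk y)) (z : ↥D.subscheme) (hz : D.subschemeι z = y) :
    IsRegularLocalRing (D.subscheme.presheaf.stalk z) := by
  rw [isRegularLocalRing_stalk_subscheme_iff]
  have hz' : D.subschemeι.base z = y := hz
  rw [hz', h]
  exact isRegularLocalRing_of_isField ((Ideal.Quotient.maximal_ideal_iff_isField_quotient _).mp inferInstance)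

/-! ## The axis section -/

/-- **B6b ★ T-AXIS-SECTION (generic form).** Let `O ↠ k` be a complete discrete valuation ring with algebraically closed residue
field, `f : X₁ → Spec O` proper with `X₁` locally Noetherian, `j₂ : F₂ → X₁` its special fibre (a pull-back square), `C` an
ideal sheaf on `X₁` and `y′ ∈ F₂` a closed point with `p := j₂ y′ ∈ supp C` such that: `p` is the only point of `supp C` on the
special fibre, `𝒪_{X₁,p} ⧸ C_p ≃+* O`, and `V(C·𝒪_{F₂})` is regular over `y′`. Then there is a section `s_c` of `f` with
`s_c(s₀) = p`, `C ≤ ker s_c`, `(ker s_c)_p = C_p`, `V(ker s_c)` regular and `O`-flat. Instantiate `f := τ₁ ≫ r′`,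
`C := (ker s).comap τ₁ ⊔ strictTransformIdeal τ₁ (ker s) L₁ ⊔ strictTransformIdeal τ₁ (ker s) L₂` for res-type-100's B6b.
[cite: Grothendieck1967, Thm. 18.5.17] [OURS · L1 W4.5b] toward `stub_elnat_tcPlusPointResolution`; NOT a statement of the manuscript. -/
theorem exists_axisSection (O : Type) [CommRing O] [IsDomain O] [IsDiscreteValuationRing O]
    [IsAdicComplete (maximalIdeal O) O] [IsAlgClosed (ResidueField O)] (k : Type) [Field k]
    (θ : O →+* k) (hθ : Function.Surjective θ) (X₁ F₂ : Scheme.{0}) [IsLocallyNoetherian X₁]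
    (f : X₁ ⟶ Spec (.of O)) [IsProper f]
    (j₂ : F₂ ⟶ X₁) (t₂ : F₂ ⟶ Spec (.of k)) (hsq : IsPullback j₂ t₂ f (Spec.map (CommRingCat.ofHom θ)))
    (C : X₁.IdealSheafData) (y' : F₂) (hy'cl : IsClosed ({y'} : Set F₂)) (hyC : j₂ y' ∈ (C.support : Set X₁))
    (hsupp : ∀ x ∈ (C.support : Set X₁), f x = closedPoint O → x = j₂ y')
    (eO : (X₁.presheaf.stalk (j₂ y') ⧸ stalkIdeal C (j₂ y')) ≃+* O)
    (hfib : ∀ y'' : ↥(C.comap j₂).subscheme, (C.comap j₂).subschemeι y'' = y' →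
      IsRegularLocalRing ((C.comap j₂).subscheme.presheaf.stalk y'')) :
    ∃ s : Spec (.of O) ⟶ X₁, s ≫ f = 𝟙 _ ∧ s (closedPoint O) = j₂ y' ∧ C ≤ s.ker ∧
      stalkIdeal s.ker (j₂ y') = stalkIdeal C (j₂ y') ∧
      Scheme.IsRegular s.ker.subscheme ∧ Flat (s.ker.subschemeι ≫ f) := by
  -- the quotient stalk at `p` is a DVR: regular, a domain, not a field
  set p := j₂ y' with hp
  have hdom : IsDomain (X₁.presheaf.stalk p ⧸ stalkIdeal C p) := MulEquiv.isDomain O eO.toMulEquiv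
  have hprime : (stalkIdeal C p).IsPrime := (Ideal.Quotient.isDomain_iff_prime _).mp hdom
  have hreg : IsRegularLocalRing (X₁.presheaf.stalk p ⧸ stalkIdeal C p) :=
    IsRegularLocalRing.of_ringEquiv eO.symm
  have hnotmax : stalkIdeal C p ≠ maximalIdeal (X₁.presheaf.stalk p) := by
    intro h
    have hF : IsField (X₁.presheaf.stalk p ⧸ stalkIdeal C p) := by
      rw [← Ideal.Quotient.maximal_ideal_iff_isField_quotient, h]
      infer_instance
    exact IsDiscreteValuationRing.not_isField O (MulEquiv.isField hF eO.symm.toMulEquiv)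
  -- (1) `V(C)` is regular: at its unique special point by `eO`, hence everywhere
  haveI : UniversallyClosed (C.subschemeι ≫ f) := inferInstance
  have hCreg : Scheme.IsRegular C.subscheme :=
    Scheme.isRegular_subscheme_of_forall_over_closedPoint f C fun x hx hfx => by
      obtain rfl := hsupp x hx hfx
      exact hreg
  -- (2) `V(C)` is horizontal: the generisation `η_𝔞` of `p`, `𝔞 = C_p`, lies in `supp C` off the special fibre
  have hhor : ∀ x₀ ∈ (C.support : Set X₁), ∃ c ∈ (C.support : Set X₁),
      c ∉ f ⁻¹' {closedPoint O} ∧ c ⤳ x₀ := by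
    intro x₀ hx₀
    by_cases hfx : f x₀ = closedPoint O
    · obtain rfl := hsupp x₀ hx₀ hfx
      let q : PrimeSpectrum (X₁.presheaf.stalk (j₂ y')) := ⟨stalkIdeal C (j₂ y'), hprime⟩
      have hq : X₁.fromSpecStalk (j₂ y') q ⤳ j₂ y' := fromSpecStalk_specializes q
      have hqC : X₁.fromSpecStalk (j₂ y') q ∈ (C.support : Set X₁) := by
        have h := (mem_support_iff_stalkIdeal_le_primeOfSpecializes hq C).mpr
          (by rw [primeOfSpecializes_fromSpecStalk])
        exact h
      refine ⟨_, hqC, fun hc => ?_, hq⟩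
      -- if `η_𝔞` were special it would be `p`, forcing `𝔞 = 𝔪_p`
      have heq : X₁.fromSpecStalk (j₂ y') q = j₂ y' := hsupp _ hqC hc
      apply hnotmax
      have h1 : primeOfSpecializes hq = q.asIdeal := primeOfSpecializes_fromSpecStalk q
      have h2 : X₁.fromSpecStalk (j₂ y') q = X₁.fromSpecStalk (j₂ y') (closedPoint (X₁.presheaf.stalk (j₂ y'))) := by
        rw [heq, Scheme.fromSpecStalk_closedPoint]
      have h3 : q = closedPoint (X₁.presheaf.stalk (j₂ y')) := (X₁.fromSpecStalk (j₂ y')).isEmbedding.injective h2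
      have h4 : q.asIdeal = maximalIdeal _ := by rw [h3]; rfl
      exact h4
    · exact ⟨x₀, hx₀, hfx, specializes_refl x₀⟩
  -- (3) flat, and the in-carrier section
  have hCflat : Flat (C.subschemeι ≫ f) := flat_subschemeι_comp_of_horizontal f C hCreg hhor
  obtain ⟨s, hs, hspt, hCs, hsreg, hsflat⟩ :=
    exists_inCarrier_section O k θ hθ X₁ F₂ f j₂ t₂ hsq C hCflat y' hy'cl hyC hreg hfib
  refine ⟨s, hs, hspt, hCs, ?_, hsreg, hsflat⟩
  -- (4) `(ker s)_p = C_p`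
  obtain ⟨-, -, -, hsuppker⟩ := section_isClosedImmersion_and_isRegular_ker O X₁ f s hs
  -- `(ker s)_p` is a prime: `V(ker s)` is regular at its point over `p`
  have hpker : j₂ y' ∈ (s.ker.support : Set X₁) := by
    rw [hsuppker]; exact ⟨_, hspt⟩
  have hp' : j₂ y' ∈ Set.range s.ker.subschemeι := by rwa [range_subschemeι]
  obtain ⟨p', hp'p⟩ := hp'
  haveI hkprime : (stalkIdeal s.ker (j₂ y')).IsPrime := by
    have h := (isRegularLocalRing_stalk_subscheme_iff s.ker p').mp (hsreg p')
    have hb : s.ker.subschemeι.base p' = j₂ y' := hp'p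
    rw [hb] at h
    haveI := isDomain_of_isRegularLocalRing (X₁.presheaf.stalk (j₂ y') ⧸ stalkIdeal s.ker (j₂ y'))
    exact (Ideal.Quotient.isDomain_iff_prime _).mp inferInstance
  -- `(ker s)_p ≠ 𝔪_p`: the generic point of the section is a second point of `V(ker s)` generising `p`
  have hkne : stalkIdeal s.ker (j₂ y') ≠ maximalIdeal (X₁.presheaf.stalk (j₂ y')) := by
    intro hmax
    let ηO : Spec (.of O) := ⟨(⊥ : Ideal O), Ideal.isPrime_bot⟩
    have hζp : s ηO ⤳ j₂ y' := by
      rw [← hspt]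
      exact (IsLocalRing.specializes_closedPoint ηO).map s.continuous
    have hζ : s ηO ∈ (s.ker.support : Set X₁) := by rw [hsuppker]; exact ⟨_, rfl⟩
    have hle : stalkIdeal s.ker (j₂ y') ≤ primeOfSpecializes hζp :=
      (mem_support_iff_stalkIdeal_le_primeOfSpecializes hζp s.ker).mp hζ
    rw [hmax] at hle
    have hP : primeOfSpecializes hζp = maximalIdeal _ :=
      le_antisymm (IsLocalRing.le_maximalIdeal Ideal.IsPrime.ne_top') hle
    -- hence `s ηO = p`
    have hpζ : j₂ y' ⤳ s ηO := by
      refine specializes_of_primeOfSpecializes_le hζp (specializes_refl _) ?_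
      rw [primeOfSpecializes_refl, hP]
    have heq : s ηO = j₂ y' := (hζp.antisymm hpζ).eq
    -- but `f (s ηO) = ηO ≠ s₀ = f p`
    have h1 : f (s ηO) = ηO := by rw [← Scheme.Hom.comp_apply, hs]; rfl
    have h2 : f (j₂ y') = closedPoint O := by rw [← hspt, ← Scheme.Hom.comp_apply, hs]; rfl
    rw [heq, h2] at h1
    exact IsDiscreteValuationRing.not_a_field O (congrArg PrimeSpectrum.asIdeal h1)
  exact eq_of_le_of_quotient_ringEquiv_of_ne_maximalIdeal O eO (stalkIdeal_mono hCs _) hkne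

end Summit.ResolutionOfSingularities.ResolutionOfSingularities.Cruxes.EquisingularLiftNat.Sections

end
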